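import Literature.AlgebraicGeometry.HodgeTheory.CyclicReflectionEigenprojectors
import Literature.AlgebraicGeometry.HodgeTheory.BilinFormComplexSpanNondegenerate
import HarnessLib

/-!
# The hermitian form `h(x, y) = B_ℂ(x̄, y)` is non-degenerate on each eigenspace `H(ζ^j)`
# (Carlson–Toledo 1999, §5: "the hermitian spaces `(H(μ), h)`") — packaging, part 6b

Family `hodge`, layer `Literature/AlgebraicGeometry/HodgeTheory`. THEOREMS only, for crux K1 of
`Summits/HodgeConjecture/HodgeConjecture/Theses/CyclicUnitaryPowers.lean` (lane D glue: hypothesis `h1` of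
`Katz1990_goursatKolchinRibet_specialLinear'.of_unitary_commutators` wants, at each place `E_j = H(ζ^j)`, a
hermitian form that `IsSymm` and is `Nondegenerate`).  For `B` symmetric non-degenerate on the finite-dimensional
rational space `V`: `B_ℂ` is non-degenerate on `V ⊗ ℂ` (Gram determinant of a basis), hence so is `h`; and
since `h` pairs `H(ζ^j)` only with itself among the eigenspaces of the isometry `τ ⊗ ℂ` of prime order `p`
(`V ⊗ ℂ = ⊕_m H(ζ^m)` by the eigenprojectors), the restriction `h|H(ζ^j)` (`LinearMap.domRestrict₁₂`) is a
non-degenerate hermitian form.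
Written by the prover seat `hodge-nonav-prover-Ax`.

## References
* [CarlsonToledo1999] J. A. Carlson, D. Toledo, *Discriminant complements and kernels of monodromy
  representations*, Duke Math. J. 97 (1999), §5 (p. 11) ("a nondegenerate … hermitian form `h` on each
  eigenspace"), §2 (p. 5).
-/

noncomputable section

open Module Literature.AlgebraicGeometry.Motives
open scoped TensorProduct ComplexConjugate

namespace Literature.AlgebraicGeometry.HodgeTheory

universe v

variable {V : Type v} [AddCommGroup V] [Module ℚ V]

/-! ### §1 `B_ℂ` and `h` are non-degenerate -/

/-- **`B_ℂ` is non-degenerate** (left): for `B` symmetric non-degenerate on a finite-dimensional `V`, a vector of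
`V ⊗ ℂ` that is `B_ℂ`-orthogonal to everything vanishes (Gram determinant of a rational basis).
[cite: CarlsonToledo1999, §2 (p. 5)] -/
theorem eq_zero_of_forall_baseChange_eq_zero [Module.Finite ℚ V] {B : LinearMap.BilinForm ℚ V} (hB : B.IsSymm)
    (hBn : B.Nondegenerate) (x : ℂ ⊗[ℚ] V) (h0 : ∀ y, B.baseChange ℂ x y = 0) : x = 0 := by
  set v := Module.finBasis ℚ V with hv
  have hnd : ∀ z ∈ Submodule.span ℚ (Set.range v), (∀ y ∈ Submodule.span ℚ (Set.range v), B z y = 0) → z = 0 :=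
    fun z _ hz => hBn.1 z fun y => hz y (by rw [v.span_eq]; trivial)
  have hx : x ∈ Submodule.span ℂ (Set.range fun i => (1 : ℂ) ⊗ₜ[ℚ] v i) := by
    have htop : Submodule.span ℂ (Set.range fun i => (1 : ℂ) ⊗ₜ[ℚ] v i) = ⊤ := by
      have hfun : (fun i => (1 : ℂ) ⊗ₜ[ℚ] v i) = ⇑(Algebra.TensorProduct.basis ℂ v) :=
        funext fun i => (Algebra.TensorProduct.basis_apply v i).symm
      rw [hfun]
      exact (Algebra.TensorProduct.basis ℂ v).span_eq
    rw [htop]; trivial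
  exact eq_zero_of_mem_span_tmul_of_forall_baseChange_eq_zero hB (⇑v) v.linearIndependent hnd hx fun k => h0 _

/-- **`h` is non-degenerate, left**: `h(x, ·) = 0` forces `x = 0`. [cite: CarlsonToledo1999, §5 (p. 11)] -/
theorem eq_zero_of_forall_hermitianOfBilin_left_eq_zero [Module.Finite ℚ V] {B : LinearMap.BilinForm ℚ V}
    (hB : B.IsSymm) (hBn : B.Nondegenerate) (x : ℂ ⊗[ℚ] V) (h0 : ∀ y, hermitianOfBilin B x y = 0) : x = 0 := by
  have h := eq_zero_of_forall_baseChange_eq_zero hB hBn (conjV V x) fun y => by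
    rw [← hermitianOfBilin_apply]; exact h0 y
  rw [← conjV_conjV x, h, map_zero]

/-- **`h` is non-degenerate, right**: `h(·, y) = 0` forces `y = 0`. [cite: CarlsonToledo1999, §5 (p. 11)] -/
theorem eq_zero_of_forall_hermitianOfBilin_right_eq_zero [Module.Finite ℚ V] {B : LinearMap.BilinForm ℚ V}
    (hB : B.IsSymm) (hBn : B.Nondegenerate) (y : ℂ ⊗[ℚ] V) (h0 : ∀ x, hermitianOfBilin B x y = 0) : y = 0 := by
  refine eq_zero_of_forall_baseChange_eq_zero hB hBn y fun z => ?_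
  have hs := (LinearMap.BilinForm.IsSymm.baseChange (A := ℂ) (LinearMap.BilinForm.isSymm_iff.1 hB)).eq y z
  rw [RingHom.id_apply] at hs
  rw [hs, ← conjV_conjV z, ← hermitianOfBilin_apply]
  exact h0 _

/-- **`h` is a non-degenerate hermitian form on `V ⊗ ℂ`.** [cite: CarlsonToledo1999, §5 (p. 11)] -/
theorem nondegenerate_hermitianOfBilin [Module.Finite ℚ V] {B : LinearMap.BilinForm ℚ V} (hB : B.IsSymm)
    (hBn : B.Nondegenerate) : (hermitianOfBilin B).Nondegenerate :=
  ⟨fun x hx => eq_zero_of_forall_hermitianOfBilin_left_eq_zero hB hBn x hx,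
    fun y hy => eq_zero_of_forall_hermitianOfBilin_right_eq_zero hB hBn y hy⟩

/-! ### §2 `h` pairs `H(ζ^j)` only with `H(ζ^j)` -/

/-- `conj(ζ^j) · ζ^m ≠ 1` for a primitive `p`-th root of unity `ζ` and `j ≠ m` below `p`.
[cite: CarlsonToledo1999, §5 (p. 11)] -/
theorem conj_pow_mul_pow_ne_one {p : ℕ} {ζ : ℂ} (hζ : IsPrimitiveRoot ζ p) (hp : 0 < p) {j m : ℕ} (hj : j < p)
    (hm : m < p) (hmj : m ≠ j) : conj (ζ ^ j) * ζ ^ m ≠ 1 := by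
  have hζ0 : ζ ≠ 0 := hζ.ne_zero hp.ne'
  have hζ1 : ‖ζ‖ = 1 := hζ.norm'_eq_one hp.ne'
  intro h1
  rw [map_pow, ← Complex.inv_eq_conj hζ1, inv_pow] at h1
  have hjm' : ζ ^ m = ζ ^ j := by
    have := congrArg (fun z => ζ ^ j * z) h1
    simp only [← mul_assoc, mul_inv_cancel₀ (pow_ne_zero j hζ0), one_mul, mul_one] at this
    exact this
  exact hmj (hζ.pow_inj hm hj hjm')

/-- For `x ∈ H(ζ^j)`: `h(x, y) = h(x, π_j y)` — only the `H(ζ^j)`-component of `y` pairs with `x`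
(`V ⊗ ℂ = ⊕_m H(ζ^m)`, eigenspace `h`-orthogonality). [cite: CarlsonToledo1999, §5 (p. 11)] -/
theorem hermitianOfBilin_eq_cyclicEigenProjector_right {τ : V →ₗ[ℚ] V} {p : ℕ} (hτ : τ ^ p = 1) {ζ : ℂ}
    (hζ : IsPrimitiveRoot ζ p) (hp : 0 < p) {B : LinearMap.BilinForm ℚ V} (hτB : ∀ v w, B (τ v) (τ w) = B v w)
    {j : ℕ} (hj : j < p) {x : ℂ ⊗[ℚ] V} (hx : x ∈ Module.End.eigenspace (τ.baseChange ℂ) (ζ ^ j))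
    (y : ℂ ⊗[ℚ] V) : hermitianOfBilin B x y = hermitianOfBilin B x (cyclicEigenProjector τ p ζ j y) := by
  have hζ0 : ζ ≠ 0 := hζ.ne_zero hp.ne'
  conv_lhs => rw [← sum_cyclicEigenProjector (τ := τ) hζ hp y]
  rw [map_sum, Finset.sum_eq_single j]
  · intro m hm hmj
    exact hermitianOfBilin_eq_zero_of_mem_eigenspace hτB (conj_pow_mul_pow_ne_one hζ hp hj (Finset.mem_range.1 hm) hmj)
      hx (cyclicEigenProjector_mem_eigenspace hτ hζ.pow_eq_one hζ0 m y)
  · intro hj'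
    exact absurd (Finset.mem_range.2 hj) hj'

/-- For `y ∈ H(ζ^j)`: `h(x, y) = h(π_j x, y)`. [cite: CarlsonToledo1999, §5 (p. 11)] -/
theorem hermitianOfBilin_eq_cyclicEigenProjector_left {τ : V →ₗ[ℚ] V} {p : ℕ} (hτ : τ ^ p = 1) {ζ : ℂ}
    (hζ : IsPrimitiveRoot ζ p) (hp : 0 < p) {B : LinearMap.BilinForm ℚ V} (hB : B.IsSymm)
    (hτB : ∀ v w, B (τ v) (τ w) = B v w) {j : ℕ} (hj : j < p) (x : ℂ ⊗[ℚ] V) {y : ℂ ⊗[ℚ] V}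
    (hy : y ∈ Module.End.eigenspace (τ.baseChange ℂ) (ζ ^ j)) :
    hermitianOfBilin B x y = hermitianOfBilin B (cyclicEigenProjector τ p ζ j x) y := by
  have hs := isSymm_hermitianOfBilin (V := V) hB
  rw [← hs.eq y x, ← hs.eq y (cyclicEigenProjector τ p ζ j x),
    hermitianOfBilin_eq_cyclicEigenProjector_right hτ hζ hp hτB hj hy x]

/-! ### §3 The restriction of `h` to `H(ζ^j)` -/

/-- The restriction `h|E` to a subspace is hermitian. [cite: CarlsonToledo1999, §5 (p. 11)] -/
theorem isSymm_hermitianOfBilin_domRestrict {B : LinearMap.BilinForm ℚ V} (hB : B.IsSymm)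
    (E : Submodule ℂ (ℂ ⊗[ℚ] V)) : ((hermitianOfBilin B).domRestrict₁₂ E E).IsSymm :=
  ⟨fun x y => by simpa [LinearMap.domRestrict₁₂_apply] using (isSymm_hermitianOfBilin hB).eq (x : ℂ ⊗[ℚ] V) y⟩

/-- **`(H(ζ^j), h)` is a non-degenerate hermitian space**: the restriction of `h` to the eigenspace `H(ζ^j)` of
the isometry `τ ⊗ ℂ` (`τ^p = 1`, `ζ` primitive, `j < p`; `B` symmetric non-degenerate, `V` finite-dimensional)
is `Nondegenerate`. [cite: CarlsonToledo1999, §5 (p. 11)] -/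
theorem nondegenerate_hermitianOfBilin_domRestrict_eigenspace [Module.Finite ℚ V] {τ : V →ₗ[ℚ] V} {p : ℕ}
    (hτ : τ ^ p = 1) {ζ : ℂ} (hζ : IsPrimitiveRoot ζ p) (hp : 0 < p) {B : LinearMap.BilinForm ℚ V}
    (hB : B.IsSymm) (hBn : B.Nondegenerate) (hτB : ∀ v w, B (τ v) (τ w) = B v w) {j : ℕ} (hj : j < p) :
    ((hermitianOfBilin B).domRestrict₁₂ (Module.End.eigenspace (τ.baseChange ℂ) (ζ ^ j))
      (Module.End.eigenspace (τ.baseChange ℂ) (ζ ^ j))).Nondegenerate := by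
  have hζ0 : ζ ≠ 0 := hζ.ne_zero hp.ne'
  refine ⟨fun x hx => ?_, fun y hy => ?_⟩
  · refine Subtype.ext (eq_zero_of_forall_hermitianOfBilin_left_eq_zero hB hBn _ fun y => ?_)
    rw [hermitianOfBilin_eq_cyclicEigenProjector_right hτ hζ hp hτB hj x.2 y]
    have h := hx ⟨cyclicEigenProjector τ p ζ j y, cyclicEigenProjector_mem_eigenspace hτ hζ.pow_eq_one hζ0 j y⟩
    simpa [LinearMap.domRestrict₁₂_apply] using h
  · refine Subtype.ext (eq_zero_of_forall_hermitianOfBilin_right_eq_zero hB hBn _ fun x => ?_)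
    rw [hermitianOfBilin_eq_cyclicEigenProjector_left hτ hζ hp hB hτB hj x y.2]
    have h := hy ⟨cyclicEigenProjector τ p ζ j x, cyclicEigenProjector_mem_eigenspace hτ hζ.pow_eq_one hζ0 j x⟩
    simpa [LinearMap.domRestrict₁₂_apply] using h

end Literature.AlgebraicGeometry.HodgeTheory

end
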